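import Summits.QuantumFields.YangMills.Theorems.BalabanUVNodesN15PerCubeGreenFineCutRows
import Summits.QuantumFields.YangMills.Theorems.BalabanUVNodesN15PerCubeGreenAdjointRows
import HarnessLib

/-!
# N15 = NE2, road (c) — PROGRAMME (PC), (PC-E-K) ENTRY 2 «`G′(U)∇*_U` of [B9] (3.42) for the NAMED scalar covariant Green's function, TWO GRIDS»: THE SITE KIT OF THE ADJOINT KNIT AT THE
# FINE GRID `ScX′` (spacing `(L^r·L^k)⁻¹`), part 1 — margins, the plateau-compressed cube `N′_k = M_{ψ′_k}G′(1)M_{ψ′_k}` with its cut rows, and its EXACT flat right locality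
# (dag-n15-c g37, n15-c∕428b; the LITERAL `ScX′` twin of n15-c∕282a `…PerCubeGreenAdjointRows`; part 2 = n15-c∕428c `…PerCubeGreenFineAdjointRightEntries`)

Cell `pub-ymgap`, seat `pub-ymgap-dag-n15-c` (generation g37; R134 (a), s1; HUMAN RULING D-0062).  `bears_on: R4∕N15 · K3⁸ SpineGivenEndpointR13SepCoPHV (stmt-QuantumFields-27366)`;
filed `--kind proof --supports stmt-QuantumFields-27366 --as helper` — COUNT-NEUTRAL.  Theorems only; 0 `def`, 0 `sorry`.  Imports BY NAME n15-c∕327 `…PerCubeGreenFineCutRows`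
(`hasMaj_cut∕cutF∕cutB_scCube'`; through it n15-c∕326 `…PerCubeGreenFineRows`: `lapOp_add_scQQ'_comp_cGreen`, `scQQ'_apply`, `mulOp_scPsi'_idem`, `scCube'_comp_mulOp_scPsi'`,
`mulOp_scH'_comp_mulOp_scPsi'`, `scBump'_eq_one_of_scH'_ne_zero_of_blockOf_eq`, and n15-c∕325's fine objects `ScX′ scChi′ scPsi′ scBump′ scH′ scQQ′ scCube′ scShift′`) and n15-c∕282a
`…PerCubeGreenAdjointRows` (for its imports: n15-c∕172 `chiCube_box_shift`, dag-n15-w3 `mulOp_comp_fgrad∕bgrad_comp_mulOp_of_margin`, `mulOp_comp_lapOp_comp_mulOp`).  Nothing in the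
tree is modified; nothing restated (every statement below lives on the FINE carrier `ScX′ = Tor (fine (L^rL^k) M)`, where n15-c∕282a's live on `ScX = Tor (fine (L^k) M)`).

WHY.  The two-grid `η`-defect of entry 2 (n15-c∕427 `uN_hasMaj_idef_rightInverse_comp_localGauges_cov_tr`, ✓) displays n15-c∕281′'s one-grid site hypotheses AT BOTH GRIDS; n15-c∕283′
discharged them at the coarse grid from n15-c∕282a∕282b; the site knit of 427 (n15-c∕429) needs the same discharges on `ScX′`.  As for entry 0 (n15-c∕326–329 twinned n15-c∕260–263),
the fine site kit is the literal twin: same proofs, spacing `L^k ↦ L^rL^k`, objects primed.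

WHAT (twins of n15-c∕282a, same names primed).  §1 `scPsi'_near_scChi'`, `mulOp_scChi'_comp_mulOp_scPsi'`, `mulOp_scChi'_comp_fgrad∕bgrad_comp_mulOp_scPsi'`,
`mulOp_scPsi'_comp_fgrad∕bgrad_comp_mulOp_scChi'`.  §2 `scCubeP'_comp_mulOp_scPsi'`, ★ `hasMaj_cut∕cutF∕cutB_scCubeP'`.  §4 ★★ `cGreen_comp_lapOp_add_scQQ'`,
`mulOp_one_sub_scPsi'_comp_lapOp_comp_mulOp_scH'`, `mulOp_one_sub_scPsi'_comp_scQQ'_comp_mulOp_scH'`, ★★★ `scCubeP'_flat_rightLocality`.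

HONEST FRAMING ∕ LIMITS.  Lattice plumbing on the MODEL site carrier of the fine grid (doubled torus of the cover); the flat rows are HYPOTHESES in dag-n15-a Ξ-4's shape
(`flatRowsAll_king` at `n = r` supplies them); nothing of [B5]∕[B6]∕[B9] asserted ((3.42) p.397 at `U ≡ 1`, (3.62)–(3.65) pp.402–403, (3.87) p.409 = SHAPES).  NE2⁺ NOT PRINTED, NOT
proved; N15 of record untouched (DISCHARGED AS CONSUMED, p687738); K3⁸ OPEN; counts of record UNMOVED (typed 28∕28 · discharged 8∕27); one finite 𝕋⁴ at fixed ε per index — NOT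
infinite volume, NOT OS on ℝ⁴, NOT a mass gap, NOT Clay.  Restate-immune (no Theses import).
-/

noncomputable section

open scoped BigOperators Matrix

namespace Summit.QuantumFields.YangMills.BalabanUVNodes.N15.Gluing

open Real
open Literature.MathematicalPhysics.QuantumFieldTheory.Balaban1983to89
open Literature.MathematicalPhysics.QuantumFieldTheory.Balaban1983to89.B5Prop11Plancherel (Tor fine unitVec)
open Literature.MathematicalPhysics.QuantumFieldTheory.Balaban1983to89.B11SectG (BlockNorm HasMaj RowSum hasMaj_comp_exp)
open Literature.MathematicalPhysics.QuantumFieldTheory.Balaban1983to89.B6RandomWalk (Triangle254)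
open Literature.MathematicalPhysics.QuantumFieldTheory.Balaban1983to89.B6Prop26Gluing (mulOp mulOp_apply ind ind_nonneg)
open Literature.MathematicalPhysics.QuantumFieldTheory.Balaban1983to89.B6UnitTorusCarrier (unitTorusGeo unitTorusGeo_dist unitTorusGeo_dist_self unitTorusGeo_dist_nonneg triangle254_unitTorusGeo)
open Literature.MathematicalPhysics.QuantumFieldTheory.Balaban1983to89.B9Eq3130MatrixLetters (hasMaj_id_ofBlocks)
open Literature.MathematicalPhysics.QuantumFieldTheory.Balaban1983to89.T4EtaRateCoeffDefect (pull pull_apply diagK diagK_nonneg hasMaj_pull hasMaj_mulOp)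
open Literature.MathematicalPhysics.QuantumFieldTheory.King1986.Torus (blockOf tdistT tdistT_nonneg tdistT_triangle tdistT_symm)
open Summit.QuantumFields.YangMills.BalabanUVNodes.N15.BackgroundLayer (fgrad bgrad fgrad_apply bgrad_apply)
open Summit.QuantumFields.YangMills.BalabanUVNodes.N15.MatrixSpecies (liftBlk liftEquiv liftEquiv_apply liftEquiv_symm_apply)
open Summit.QuantumFields.YangMills.BalabanUVNodes.N15.VectorPiece (bshiftEquiv hasMaj_pull_comp)
open Summit.QuantumFields.YangMills.BalabanUVNodes.N15.TwoGrid (chiCube cubeBlocks chiCube_of_not_mem abs_chiCube_le_one)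
open Summit.QuantumFields.YangMills.BalabanUVNodes.N15.CurvedSpecies (mulOp_comp_fgrad_comp_mulOp_of_margin mulOp_comp_bgrad_comp_mulOp_of_margin mulOp_comp_lapOp_comp_mulOp)
open Summit.QuantumFields.YangMills.BalabanUVNodes.N15.CovLandau (cgrad cGreen bBack cgrad_mulVec cgrad_one_transpose_mulVec)

variable {d : ℕ}

/-! ## §1 The one-block margin of the box `{χ_k ≠ 0}` inside the cube `{ψ_k = 1}` on sites -/

section Margin

variable {L : ℕ} [NeZero L] {mv kk r : ℕ} {hL : Odd L ∧ 1 < L} (ι : Type)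
variable (hM : ∀ ν, cvM d L mv kk hL ν = 2 * L * L ^ mv) (hm₂ : 2 * L ^ mv + 1 ≤ coverMargin L mv) (hfit₂ : coverMargin L mv - 2 * L ^ mv + (6 * L ^ mv + 1) + 1 ≤ L * L ^ mv)
  (hS0 : L * L ^ mv ≤ 2 * L * L ^ mv)
include hM hm₂ hfit₂ hS0

/-- THE MARGIN: `χ_k(x) ≠ 0 ⟹ ψ_k(x) = ψ_k(x + e_μ) = ψ_k(x − e_μ) = 1` (n15-c∕172 `chiCube_box_shift` at the bond `(x, 0)`). [cite: Balaban1985BackgroundPropagators, (3.62)–(3.65) pp.402–403 (nested cut-offs: shape)] -/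
theorem scPsi'_near_scChi' (μ : Fin (d + 1)) (k : Fin (d + 1) → ZMod (2 * L)) {x : ScX' d L mv kk r hL} (hx : scChi' d L mv kk r hL k x ≠ 0) :
    scPsi' d L mv kk r hL k x = 1 ∧ scPsi' d L mv kk r hL k (scShift' d L mv kk r hL μ x) = 1 ∧ scPsi' d L mv kk r hL k ((scShift' d L mv kk r hL μ).symm x) = 1 := by
  have h := chiCube_box_shift (n := L ^ r * L ^ kk) hM hm₂ hfit₂ hS0 μ (x := (x, (0 : Fin (d + 1)))) hx
  refine ⟨h.1, h.2.1, ?_⟩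
  have e : scPsi' d L mv kk r hL k ((scShift' d L mv kk r hL μ).symm x) =
      chiCube (cvM d L mv kk hL) (L ^ r * L ^ kk) (coverCorner (cvM d L mv kk hL) (L ^ mv) L (coverMargin L mv) k) (L * L ^ mv) ((bshiftEquiv (cvM d L mv kk hL) (L ^ r * L ^ kk) μ).symm (x, 0)) := by
    rw [← scShift'_symm_apply]
  rw [e]; exact h.2.2

/-- `M_{χ_k}∘M_{ψ_k} = M_{χ_k}`. [folklore] -/
theorem mulOp_scChi'_comp_mulOp_scPsi' (k : Fin (d + 1) → ZMod (2 * L)) :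
    mulOp (fun p : ScX' d L mv kk r hL × ι => scChi' d L mv kk r hL k p.1) ∘ₗ mulOp (fun p : ScX' d L mv kk r hL × ι => scPsi' d L mv kk r hL k p.1) =
      mulOp (fun p : ScX' d L mv kk r hL × ι => scChi' d L mv kk r hL k p.1) :=
  mulOp_comp_mulOp_of_support fun _ hp => (scPsi'_near_scChi' hM hm₂ hfit₂ hS0 0 k hp).1

/-- `M_{χ_k}∘∇⁺_μ∘M_{ψ_k} = M_{χ_k}∘∇⁺_μ` (the forward quotient at a box point reads the point and its forward neighbour, both under the plateau). [folklore] -/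
theorem mulOp_scChi'_comp_fgrad_comp_mulOp_scPsi' (cc : ℝ) (μ : Fin (d + 1)) (k : Fin (d + 1) → ZMod (2 * L)) :
    mulOp (fun p : ScX' d L mv kk r hL × ι => scChi' d L mv kk r hL k p.1) ∘ₗ fgrad cc (liftEquiv (scShift' d L mv kk r hL μ) ι) ∘ₗ mulOp (fun p : ScX' d L mv kk r hL × ι => scPsi' d L mv kk r hL k p.1) =
      mulOp (fun p : ScX' d L mv kk r hL × ι => scChi' d L mv kk r hL k p.1) ∘ₗ fgrad cc (liftEquiv (scShift' d L mv kk r hL μ) ι) :=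
  mulOp_comp_fgrad_comp_mulOp_of_margin cc (scShift' d L mv kk r hL μ) fun _ hx => ⟨(scPsi'_near_scChi' hM hm₂ hfit₂ hS0 μ k hx).1, (scPsi'_near_scChi' hM hm₂ hfit₂ hS0 μ k hx).2.1⟩

/-- `M_{χ_k}∘∇⁻_μ∘M_{ψ_k} = M_{χ_k}∘∇⁻_μ`. [folklore] -/
theorem mulOp_scChi'_comp_bgrad_comp_mulOp_scPsi' (cc : ℝ) (μ : Fin (d + 1)) (k : Fin (d + 1) → ZMod (2 * L)) :
    mulOp (fun p : ScX' d L mv kk r hL × ι => scChi' d L mv kk r hL k p.1) ∘ₗ bgrad cc (liftEquiv (scShift' d L mv kk r hL μ) ι) ∘ₗ mulOp (fun p : ScX' d L mv kk r hL × ι => scPsi' d L mv kk r hL k p.1) =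
      mulOp (fun p : ScX' d L mv kk r hL × ι => scChi' d L mv kk r hL k p.1) ∘ₗ bgrad cc (liftEquiv (scShift' d L mv kk r hL μ) ι) :=
  mulOp_comp_bgrad_comp_mulOp_of_margin cc (scShift' d L mv kk r hL μ) fun _ hx => ⟨(scPsi'_near_scChi' hM hm₂ hfit₂ hS0 μ k hx).1, (scPsi'_near_scChi' hM hm₂ hfit₂ hS0 μ k hx).2.2⟩

/-- `M_{ψ_k}∘∇⁺_μ∘M_{χ_k} = ∇⁺_μ∘M_{χ_k}` (the forward quotient of a box-cut field lives under the plateau). [folklore] -/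
theorem mulOp_scPsi'_comp_fgrad_comp_mulOp_scChi' (cc : ℝ) (μ : Fin (d + 1)) (k : Fin (d + 1) → ZMod (2 * L)) :
    mulOp (fun p : ScX' d L mv kk r hL × ι => scPsi' d L mv kk r hL k p.1) ∘ₗ fgrad cc (liftEquiv (scShift' d L mv kk r hL μ) ι) ∘ₗ mulOp (fun p : ScX' d L mv kk r hL × ι => scChi' d L mv kk r hL k p.1) =
      fgrad cc (liftEquiv (scShift' d L mv kk r hL μ) ι) ∘ₗ mulOp (fun p : ScX' d L mv kk r hL × ι => scChi' d L mv kk r hL k p.1) := by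
  refine LinearMap.ext fun f => funext fun p => ?_
  simp only [LinearMap.comp_apply, mulOp_apply, fgrad_apply, liftEquiv_apply]
  by_cases h1 : scChi' d L mv kk r hL k (scShift' d L mv kk r hL μ p.1) = 0
  · by_cases h0 : scChi' d L mv kk r hL k p.1 = 0
    · rw [h1, h0]; ring
    · rw [(scPsi'_near_scChi' hM hm₂ hfit₂ hS0 μ k h0).1, one_mul]
  · have h := (scPsi'_near_scChi' hM hm₂ hfit₂ hS0 μ k h1).2.2
    rw [Equiv.symm_apply_apply] at h
    rw [h, one_mul]

/-- `M_{ψ_k}∘∇⁻_μ∘M_{χ_k} = ∇⁻_μ∘M_{χ_k}`. [folklore] -/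
theorem mulOp_scPsi'_comp_bgrad_comp_mulOp_scChi' (cc : ℝ) (μ : Fin (d + 1)) (k : Fin (d + 1) → ZMod (2 * L)) :
    mulOp (fun p : ScX' d L mv kk r hL × ι => scPsi' d L mv kk r hL k p.1) ∘ₗ bgrad cc (liftEquiv (scShift' d L mv kk r hL μ) ι) ∘ₗ mulOp (fun p : ScX' d L mv kk r hL × ι => scChi' d L mv kk r hL k p.1) =
      bgrad cc (liftEquiv (scShift' d L mv kk r hL μ) ι) ∘ₗ mulOp (fun p : ScX' d L mv kk r hL × ι => scChi' d L mv kk r hL k p.1) := by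
  refine LinearMap.ext fun f => funext fun p => ?_
  simp only [LinearMap.comp_apply, mulOp_apply, bgrad_apply, liftEquiv_symm_apply]
  by_cases h1 : scChi' d L mv kk r hL k ((scShift' d L mv kk r hL μ).symm p.1) = 0
  · by_cases h0 : scChi' d L mv kk r hL k p.1 = 0
    · rw [h1, h0]; ring
    · rw [(scPsi'_near_scChi' hM hm₂ hfit₂ hS0 μ k h0).1, one_mul]
  · have h := (scPsi'_near_scChi' hM hm₂ hfit₂ hS0 μ k h1).2.1
    rw [Equiv.apply_symm_apply] at h
    rw [h, one_mul]

end Margin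

/-! ## §2 The plateau-compressed cube `N′_k = M_{ψ_k}∘G′(1)∘M_{ψ_k}`: input cut and cut rows -/

section Cube

variable {L : ℕ} [NeZero L] {mv kk r : ℕ} {hL : Odd L ∧ 1 < L} (ι : Type) [Fintype ι] [DecidableEq ι]

/-- `N′_k∘M_{ψ_k} = N′_k` [hNψ]. [folklore] -/
theorem scCubeP'_comp_mulOp_scPsi' (a : ℝ) (k : Fin (d + 1) → ZMod (2 * L)) :
    (mulOp (fun p : ScX' d L mv kk r hL × ι => scPsi' d L mv kk r hL k p.1) ∘ₗ scCube' d L mv kk r hL a ι k) ∘ₗ mulOp (fun p : ScX' d L mv kk r hL × ι => scPsi' d L mv kk r hL k p.1) =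
      mulOp (fun p : ScX' d L mv kk r hL × ι => scPsi' d L mv kk r hL k p.1) ∘ₗ scCube' d L mv kk r hL a ι k := by
  rw [LinearMap.comp_assoc, scCube'_comp_mulOp_scPsi']

variable (hM : ∀ ν, cvM d L mv kk hL ν = 2 * L * L ^ mv) (hm₁ : 2 * L ^ mv ≤ coverMargin L mv) (hfitI : coverMargin L mv - 2 * L ^ mv + (6 * L ^ mv + 1) ≤ L * L ^ mv)
  (hm₂ : 2 * L ^ mv + 1 ≤ coverMargin L mv) (hfit₂ : coverMargin L mv - 2 * L ^ mv + (6 * L ^ mv + 1) + 1 ≤ L * L ^ mv) (hS0 : L * L ^ mv ≤ 2 * L * L ^ mv)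
include hM hm₁ hfitI hm₂ hfit₂ hS0

/-- ★ [hcut] for `N′_k`: `M_{χ_k}∘N′_k = M_{χ_k}∘N_k ≤ 1_□1_□·Ce^{−δd}` (n15-c∕261b). [cite: Balaban1985BackgroundPropagators, (3.87) p.409, Thm 3.1 (3.42) p.397 (entry 0 at `U ≡ 1`: shape)] -/
theorem hasMaj_cut_scCubeP' {a C δ : ℝ} (hC : 0 ≤ C)
    (hG : HasMaj (ScNorm' d L mv kk r hL ι) (ScNorm' d L mv kk r hL ι) (Matrix.mulVecLin (cGreen (cvM d L mv kk hL) (L ^ r * L ^ kk) (fun (_ : Fin (d + 1)) (_ : ScX' d L mv kk r hL) => (1 : Matrix ι ι ℝ)) a))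
      (fun y y' => C * Real.exp (-(δ * tdistT (cvM d L mv kk hL) y y')))) (k : Fin (d + 1) → ZMod (2 * L)) :
    HasMaj (ScNorm' d L mv kk r hL ι) (ScNorm' d L mv kk r hL ι)
      (mulOp (fun p : ScX' d L mv kk r hL × ι => scChi' d L mv kk r hL k p.1) ∘ₗ (mulOp (fun p : ScX' d L mv kk r hL × ι => scPsi' d L mv kk r hL k p.1) ∘ₗ scCube' d L mv kk r hL a ι k))
      (fun y y' => ind (cvSk d L mv kk hL k) y * ind (cvSk d L mv kk hL k) y' * (C * Real.exp (-(δ * (unitTorusGeo L kk (cvM d L mv kk hL)).dist y y')))) := by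
  rw [← LinearMap.comp_assoc, mulOp_scChi'_comp_mulOp_scPsi' ι hM hm₂ hfit₂ hS0]
  exact hasMaj_cut_scCube' ι hM hm₁ hfitI hS0 hC hG k

/-- ★ [hcutF] for `N′_k`: `M_{χ_k}∘∇⁺_μ∘N′_k = M_{χ_k}∘∇⁺_μ∘N_k` (margin) `≤ 1_□1_□·Ce^{−δd}` (n15-c∕261b). [cite: Balaban1985BackgroundPropagators, Thm 3.1 (3.42) p.397 (entry 1 at `U ≡ 1`: shape)] -/
theorem hasMaj_cutF_scCubeP' {a C δ : ℝ} (hC : 0 < C) (μ : Fin (d + 1))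
    (hD : HasMaj (ScNorm' d L mv kk r hL ι) (BlockNorm.ofBlocks (unitTorusGeo L kk (cvM d L mv kk hL)) (liftBlk (fun b : ScX' d L mv kk r hL × Fin (d + 1) => blockOf (L ^ r * L ^ kk) (cvM d L mv kk hL) b.1) ι))
      (Matrix.mulVecLin (cgrad (cvM d L mv kk hL) (L ^ r * L ^ kk) (fun (_ : Fin (d + 1)) (_ : ScX' d L mv kk r hL) => (1 : Matrix ι ι ℝ)) *
        cGreen (cvM d L mv kk hL) (L ^ r * L ^ kk) (fun (_ : Fin (d + 1)) (_ : ScX' d L mv kk r hL) => (1 : Matrix ι ι ℝ)) a)) (fun y y' => C * Real.exp (-(δ * tdistT (cvM d L mv kk hL) y y'))))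
    (k : Fin (d + 1) → ZMod (2 * L)) :
    HasMaj (ScNorm' d L mv kk r hL ι) (ScNorm' d L mv kk r hL ι)
      (mulOp (fun p : ScX' d L mv kk r hL × ι => scChi' d L mv kk r hL k p.1) ∘ₗ (fgrad ((((L ^ r * L ^ kk : ℕ) : ℝ))⁻¹)⁻¹ (liftEquiv (scShift' d L mv kk r hL μ) ι) ∘ₗ
        (mulOp (fun p : ScX' d L mv kk r hL × ι => scPsi' d L mv kk r hL k p.1) ∘ₗ scCube' d L mv kk r hL a ι k)))
      (fun y y' => ind (cvSk d L mv kk hL k) y * ind (cvSk d L mv kk hL k) y' * (C * Real.exp (-(δ * (unitTorusGeo L kk (cvM d L mv kk hL)).dist y y')))) := by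
  have e : mulOp (fun p : ScX' d L mv kk r hL × ι => scChi' d L mv kk r hL k p.1) ∘ₗ (fgrad ((((L ^ r * L ^ kk : ℕ) : ℝ))⁻¹)⁻¹ (liftEquiv (scShift' d L mv kk r hL μ) ι) ∘ₗ
        (mulOp (fun p : ScX' d L mv kk r hL × ι => scPsi' d L mv kk r hL k p.1) ∘ₗ scCube' d L mv kk r hL a ι k)) =
      (mulOp (fun p : ScX' d L mv kk r hL × ι => scChi' d L mv kk r hL k p.1) ∘ₗ fgrad ((((L ^ r * L ^ kk : ℕ) : ℝ))⁻¹)⁻¹ (liftEquiv (scShift' d L mv kk r hL μ) ι) ∘ₗ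
        mulOp (fun p : ScX' d L mv kk r hL × ι => scPsi' d L mv kk r hL k p.1)) ∘ₗ scCube' d L mv kk r hL a ι k := by
    simp only [LinearMap.comp_assoc]
  rw [e, mulOp_scChi'_comp_fgrad_comp_mulOp_scPsi' ι hM hm₂ hfit₂ hS0, LinearMap.comp_assoc]
  exact hasMaj_cutF_scCube' ι hM hm₁ hfitI hS0 hC μ hD k

/-- ★ [hcutB] for `N′_k`. [cite: Balaban1985BackgroundPropagators, Thm 3.1 (3.42) p.397 (entry 1 at `U ≡ 1`: shape); Balaban1984PropagatorsI, (1.3) p.18] -/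
theorem hasMaj_cutB_scCubeP' {a C δ : ℝ} (hC : 0 < C) (μ : Fin (d + 1))
    (hB : HasMaj (ScNorm' d L mv kk r hL ι) (BlockNorm.ofBlocks (unitTorusGeo L kk (cvM d L mv kk hL)) (liftBlk (fun b : ScX' d L mv kk r hL × Fin (d + 1) => blockOf (L ^ r * L ^ kk) (cvM d L mv kk hL) b.1) ι))
      (Matrix.mulVecLin (bBack (cvM d L mv kk hL) (L ^ r * L ^ kk) (ι := ι) * (cgrad (cvM d L mv kk hL) (L ^ r * L ^ kk) (fun (_ : Fin (d + 1)) (_ : ScX' d L mv kk r hL) => (1 : Matrix ι ι ℝ)) *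
        cGreen (cvM d L mv kk hL) (L ^ r * L ^ kk) (fun (_ : Fin (d + 1)) (_ : ScX' d L mv kk r hL) => (1 : Matrix ι ι ℝ)) a))) (fun y y' => C * Real.exp (-(δ * tdistT (cvM d L mv kk hL) y y'))))
    (k : Fin (d + 1) → ZMod (2 * L)) :
    HasMaj (ScNorm' d L mv kk r hL ι) (ScNorm' d L mv kk r hL ι)
      (mulOp (fun p : ScX' d L mv kk r hL × ι => scChi' d L mv kk r hL k p.1) ∘ₗ (bgrad ((((L ^ r * L ^ kk : ℕ) : ℝ))⁻¹)⁻¹ (liftEquiv (scShift' d L mv kk r hL μ) ι) ∘ₗ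
        (mulOp (fun p : ScX' d L mv kk r hL × ι => scPsi' d L mv kk r hL k p.1) ∘ₗ scCube' d L mv kk r hL a ι k)))
      (fun y y' => ind (cvSk d L mv kk hL k) y * ind (cvSk d L mv kk hL k) y' * (C * Real.exp (-(δ * (unitTorusGeo L kk (cvM d L mv kk hL)).dist y y')))) := by
  have e : mulOp (fun p : ScX' d L mv kk r hL × ι => scChi' d L mv kk r hL k p.1) ∘ₗ (bgrad ((((L ^ r * L ^ kk : ℕ) : ℝ))⁻¹)⁻¹ (liftEquiv (scShift' d L mv kk r hL μ) ι) ∘ₗ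
        (mulOp (fun p : ScX' d L mv kk r hL × ι => scPsi' d L mv kk r hL k p.1) ∘ₗ scCube' d L mv kk r hL a ι k)) =
      (mulOp (fun p : ScX' d L mv kk r hL × ι => scChi' d L mv kk r hL k p.1) ∘ₗ bgrad ((((L ^ r * L ^ kk : ℕ) : ℝ))⁻¹)⁻¹ (liftEquiv (scShift' d L mv kk r hL μ) ι) ∘ₗ
        mulOp (fun p : ScX' d L mv kk r hL × ι => scPsi' d L mv kk r hL k p.1)) ∘ₗ scCube' d L mv kk r hL a ι k := by
    simp only [LinearMap.comp_assoc]
  rw [e, mulOp_scChi'_comp_bgrad_comp_mulOp_scPsi' ι hM hm₂ hfit₂ hS0, LinearMap.comp_assoc]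
  exact hasMaj_cutB_scCube' ι hM hm₁ hfitI hS0 hC μ hB k

end Cube

/-! ## §4 The EXACT flat right locality of the plateau-compressed cube on the partition -/

section Flat

variable {L : ℕ} [NeZero L] {mv kk r : ℕ} {hL : Odd L ∧ 1 < L} (ι : Type) [Fintype ι] [DecidableEq ι]

/-- ★★ `G′(1)∘Δ′_a(1) = 1` on the coloured site carrier (the RIGHT-inverse companion of n15-c∕261 `lapOp_add_scQQ'_comp_cGreen`, square matrices). [cite: Balaban1985BackgroundPropagators, (3.24)–(3.25) p.394] -/
theorem cGreen_comp_lapOp_add_scQQ' {a : ℝ} (ha : 0 < a) :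
    Matrix.mulVecLin (cGreen (cvM d L mv kk hL) (L ^ r * L ^ kk) (fun (_ : Fin (d + 1)) (_ : ScX' d L mv kk r hL) => (1 : Matrix ι ι ℝ)) a) ∘ₗ
        (lapOp (((L ^ r * L ^ kk : ℕ) : ℝ)) (fun μ => liftEquiv (scShift' d L mv kk r hL μ) ι) 0 + scQQ' d L mv kk r hL a ι) = LinearMap.id := by
  have h := congrArg LinearMap.toMatrix' (lapOp_add_scQQ'_comp_cGreen (d := d) (L := L) (mv := mv) (kk := kk) (r := r) (hL := hL) ι ha)
  rw [LinearMap.toMatrix'_comp, LinearMap.toMatrix'_id, mul_eq_one_comm] at h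
  apply LinearMap.toMatrix'.injective
  rw [LinearMap.toMatrix'_comp, LinearMap.toMatrix'_id, h]

variable (hM : ∀ ν, cvM d L mv kk hL ν = 2 * L * L ^ mv) (hm₂ : 2 * L ^ mv + 1 ≤ coverMargin L mv)
  (hfit₂ : coverMargin L mv - 2 * L ^ mv + (6 * L ^ mv + 1) + 1 ≤ L * L ^ mv) (hS0 : L * L ^ mv ≤ 2 * L * L ^ mv)
include hM hm₂ hfit₂ hS0

omit [Fintype ι] [DecidableEq ι] in
/-- `(1 − M_{ψ_k})∘Σ∇*∇∘M_{h_k} = 0`: the Laplacian of a partition-cut field lives within one step of `supp h_k ⊆ {χ_k ≠ 0}`, under the plateau (dag-n15-w3 `mulOp_comp_lapOp_comp_mulOp` at `W = 0`).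
[cite: Balaban1984PropagatorsII, (2.37) p.229 (shape)] -/
theorem mulOp_one_sub_scPsi'_comp_lapOp_comp_mulOp_scH' (cc : ℝ) (k : Fin (d + 1) → ZMod (2 * L)) (hhχ : ∀ x, scH' d L mv kk r hL k x ≠ 0 → scChi' d L mv kk r hL k x ≠ 0) :
    mulOp (fun p : ScX' d L mv kk r hL × ι => 1 - scPsi' d L mv kk r hL k p.1) ∘ₗ lapOp cc (fun μ => liftEquiv (scShift' d L mv kk r hL μ) ι) 0 ∘ₗ mulOp (fun p : ScX' d L mv kk r hL × ι => scH' d L mv kk r hL k p.1) = 0 := by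
  rw [mulOp_comp_lapOp_comp_mulOp (scShift' d L mv kk r hL) cc (hX := fun x => 1 - scPsi' d L mv kk r hL k x) (kX := scH' d L mv kk r hL k) 0 ?_ ?_ ?_, LinearMap.zero_comp, LinearMap.comp_zero]
  · intro x
    by_cases h0 : scH' d L mv kk r hL k x = 0
    · rw [h0, mul_zero]
    · rw [(scPsi'_near_scChi' hM hm₂ hfit₂ hS0 0 k (hhχ x h0)).1]; ring
  · intro μ x
    by_cases h0 : scH' d L mv kk r hL k (scShift' d L mv kk r hL μ x) = 0
    · rw [h0, mul_zero]
    · have h := (scPsi'_near_scChi' hM hm₂ hfit₂ hS0 μ k (hhχ _ h0)).2.2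
      rw [Equiv.symm_apply_apply] at h
      rw [h]; ring
  · intro μ x
    by_cases h0 : scH' d L mv kk r hL k ((scShift' d L mv kk r hL μ).symm x) = 0
    · rw [h0, mul_zero]
    · have h := (scPsi'_near_scChi' hM hm₂ hfit₂ hS0 μ k (hhχ _ h0)).2.1
      rw [Equiv.apply_symm_apply] at h
      rw [h]; ring

/-- `(1 − M_{ψ_k})∘(a·Q′ᵀQ′ ⊗ 1)∘M_{h_k} = 0`: the block-diagonal part reads the block of the output point; a block meeting `supp h_k` lies in the box (`χ_k` is block-constant) hence under the plateau.
[cite: Balaban1985BackgroundPropagators, (3.24) p.394 (block structure: shape)] -/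
theorem mulOp_one_sub_scPsi'_comp_scQQ'_comp_mulOp_scH' (a : ℝ) (k : Fin (d + 1) → ZMod (2 * L)) (hhχ : ∀ x, scH' d L mv kk r hL k x ≠ 0 → scChi' d L mv kk r hL k x ≠ 0) :
    mulOp (fun p : ScX' d L mv kk r hL × ι => 1 - scPsi' d L mv kk r hL k p.1) ∘ₗ scQQ' d L mv kk r hL a ι ∘ₗ mulOp (fun p : ScX' d L mv kk r hL × ι => scH' d L mv kk r hL k p.1) = 0 := by
  classical
  refine LinearMap.ext fun f => funext fun p => ?_
  rw [LinearMap.comp_apply, LinearMap.comp_apply, mulOp_apply, LinearMap.zero_apply, Pi.zero_apply]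
  by_cases hψ : scPsi' d L mv kk r hL k p.1 = 1
  · rw [hψ, sub_self, zero_mul]
  · rw [scQQ'_apply]
    have hzero : ∑ x' : ScX' d L mv kk r hL, (if blockOf (L ^ r * L ^ kk) (cvM d L mv kk hL) x' = blockOf (L ^ r * L ^ kk) (cvM d L mv kk hL) p.1 then
        mulOp (fun p : ScX' d L mv kk r hL × ι => scH' d L mv kk r hL k p.1) f (x', p.2) else 0) = 0 := by
      refine Finset.sum_eq_zero fun x' _ => ?_
      by_cases hb : blockOf (L ^ r * L ^ kk) (cvM d L mv kk hL) x' = blockOf (L ^ r * L ^ kk) (cvM d L mv kk hL) p.1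
      · rw [if_pos hb, mulOp_apply]
        by_cases hx : scH' d L mv kk r hL k x' = 0
        · rw [hx, zero_mul]
        · exfalso
          have hχ : scChi' d L mv kk r hL k p.1 ≠ 0 := by
            have h' := hhχ x' hx
            have e : scChi' d L mv kk r hL k p.1 = scChi' d L mv kk r hL k x' := by
              simp only [scChi', chiCube, hb]
            rwa [e]
          exact hψ (scPsi'_near_scChi' hM hm₂ hfit₂ hS0 0 k hχ).1
      · rw [if_neg hb]
    rw [hzero, mul_zero, mul_zero]

/-- ★★★ **THE EXACT FLAT RIGHT LOCALITY OF THE PLATEAU-COMPRESSED CUBE ON THE PARTITION** (n15-c∕281's `hflat0`; FILE 148's `hflat` with `F^flat = 0`):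
`(M_{χ̃_k}∘N′_k)∘(Σ∇*∇ + a·Q′ᵀQ′ ⊗ 1)∘M_{h_k} = M_{h_k}` (`a > 0`) — the plateau absorbs nothing (`M_ψΔ′M_h = Δ′M_h`), `G′(1)Δ′_a(1) = 1`, `ψ_kh_k = h_k`, `χ̃_kh_k = h_k`.
[cite: Balaban1985BackgroundPropagators, (3.87)–(3.88) p.409 (mechanism, transposed); Balaban1984PropagatorsII, (2.91) p.239] -/
theorem scCubeP'_flat_rightLocality (hw : 0 < L ^ mv) (hfit : coverMargin L mv + 2 * L ^ mv + 1 ≤ L * L ^ mv) {a : ℝ} (ha : 0 < a) (k : Fin (d + 1) → ZMod (2 * L))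
    (hhχ : ∀ x, scH' d L mv kk r hL k x ≠ 0 → scChi' d L mv kk r hL k x ≠ 0) :
    (mulOp (fun p : ScX' d L mv kk r hL × ι => scBump' d L mv kk r hL k p.1) ∘ₗ (mulOp (fun p : ScX' d L mv kk r hL × ι => scPsi' d L mv kk r hL k p.1) ∘ₗ scCube' d L mv kk r hL a ι k)) ∘ₗ
        (lapOp (((L ^ r * L ^ kk : ℕ) : ℝ)) (fun μ => liftEquiv (scShift' d L mv kk r hL μ) ι) 0 + scQQ' d L mv kk r hL a ι) ∘ₗ mulOp (fun p : ScX' d L mv kk r hL × ι => scH' d L mv kk r hL k p.1) =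
      mulOp (fun p : ScX' d L mv kk r hL × ι => scH' d L mv kk r hL k p.1) := by
  -- the plateau absorbs nothing: `M_ψ∘Δ′∘M_h = Δ′∘M_h`
  have hψΔ : mulOp (fun p : ScX' d L mv kk r hL × ι => scPsi' d L mv kk r hL k p.1) ∘ₗ (lapOp (((L ^ r * L ^ kk : ℕ) : ℝ)) (fun μ => liftEquiv (scShift' d L mv kk r hL μ) ι) 0 + scQQ' d L mv kk r hL a ι) ∘ₗ
      mulOp (fun p : ScX' d L mv kk r hL × ι => scH' d L mv kk r hL k p.1) =
      (lapOp (((L ^ r * L ^ kk : ℕ) : ℝ)) (fun μ => liftEquiv (scShift' d L mv kk r hL μ) ι) 0 + scQQ' d L mv kk r hL a ι) ∘ₗ mulOp (fun p : ScX' d L mv kk r hL × ι => scH' d L mv kk r hL k p.1) := by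
    have h1 := mulOp_one_sub_scPsi'_comp_lapOp_comp_mulOp_scH' ι hM hm₂ hfit₂ hS0 (((L ^ r * L ^ kk : ℕ) : ℝ)) k hhχ
    have h2 := mulOp_one_sub_scPsi'_comp_scQQ'_comp_mulOp_scH' ι hM hm₂ hfit₂ hS0 a k hhχ
    refine LinearMap.ext fun f => funext fun p => ?_
    have e1 := congrFun (LinearMap.congr_fun h1 f) p
    have e2 := congrFun (LinearMap.congr_fun h2 f) p
    simp only [LinearMap.comp_apply, mulOp_apply, LinearMap.zero_apply, Pi.zero_apply, LinearMap.add_apply, Pi.add_apply] at e1 e2 ⊢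
    have e3 : (1 - scPsi' d L mv kk r hL k p.1) * ((lapOp (((L ^ r * L ^ kk : ℕ) : ℝ)) (fun μ => liftEquiv (scShift' d L mv kk r hL μ) ι) 0) (mulOp (fun p : ScX' d L mv kk r hL × ι => scH' d L mv kk r hL k p.1) f) p +
        (scQQ' d L mv kk r hL a ι) (mulOp (fun p : ScX' d L mv kk r hL × ι => scH' d L mv kk r hL k p.1) f) p) = 0 := by rw [mul_add, e1, e2, add_zero]
    have e4 : ∀ u v : ℝ, (1 - u) * v = 0 → u * v = v := fun u v huv => by linarith [huv, sub_mul 1 u v]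
    exact e4 _ _ e3
  -- `ψh = h`, `χ̃h = h`
  have hψh := mulOp_scH'_comp_mulOp_scPsi' (d := d) (L := L) (mv := mv) (kk := kk) (r := r) (hL := hL) ι hM hw hfit k
  have hχth : mulOp (fun p : ScX' d L mv kk r hL × ι => scBump' d L mv kk r hL k p.1) ∘ₗ mulOp (fun p : ScX' d L mv kk r hL × ι => scH' d L mv kk r hL k p.1) =
      mulOp (fun p : ScX' d L mv kk r hL × ι => scH' d L mv kk r hL k p.1) :=
    mulOp_comp_mulOp_of_support_left fun p hp => scBump'_eq_one_of_scH'_ne_zero_of_blockOf_eq hw hp rfl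
  calc (mulOp (fun p : ScX' d L mv kk r hL × ι => scBump' d L mv kk r hL k p.1) ∘ₗ (mulOp (fun p : ScX' d L mv kk r hL × ι => scPsi' d L mv kk r hL k p.1) ∘ₗ scCube' d L mv kk r hL a ι k)) ∘ₗ
        (lapOp (((L ^ r * L ^ kk : ℕ) : ℝ)) (fun μ => liftEquiv (scShift' d L mv kk r hL μ) ι) 0 + scQQ' d L mv kk r hL a ι) ∘ₗ mulOp (fun p : ScX' d L mv kk r hL × ι => scH' d L mv kk r hL k p.1)
      = mulOp (fun p : ScX' d L mv kk r hL × ι => scBump' d L mv kk r hL k p.1) ∘ₗ mulOp (fun p : ScX' d L mv kk r hL × ι => scPsi' d L mv kk r hL k p.1) ∘ₗ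
          Matrix.mulVecLin (cGreen (cvM d L mv kk hL) (L ^ r * L ^ kk) (fun (_ : Fin (d + 1)) (_ : ScX' d L mv kk r hL) => (1 : Matrix ι ι ℝ)) a) ∘ₗ
          (mulOp (fun p : ScX' d L mv kk r hL × ι => scPsi' d L mv kk r hL k p.1) ∘ₗ (lapOp (((L ^ r * L ^ kk : ℕ) : ℝ)) (fun μ => liftEquiv (scShift' d L mv kk r hL μ) ι) 0 + scQQ' d L mv kk r hL a ι) ∘ₗ
            mulOp (fun p : ScX' d L mv kk r hL × ι => scH' d L mv kk r hL k p.1)) := by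
        simp only [scCube', LinearMap.comp_assoc]
    _ = mulOp (fun p : ScX' d L mv kk r hL × ι => scBump' d L mv kk r hL k p.1) ∘ₗ mulOp (fun p : ScX' d L mv kk r hL × ι => scPsi' d L mv kk r hL k p.1) ∘ₗ
          (Matrix.mulVecLin (cGreen (cvM d L mv kk hL) (L ^ r * L ^ kk) (fun (_ : Fin (d + 1)) (_ : ScX' d L mv kk r hL) => (1 : Matrix ι ι ℝ)) a) ∘ₗ
            (lapOp (((L ^ r * L ^ kk : ℕ) : ℝ)) (fun μ => liftEquiv (scShift' d L mv kk r hL μ) ι) 0 + scQQ' d L mv kk r hL a ι)) ∘ₗ mulOp (fun p : ScX' d L mv kk r hL × ι => scH' d L mv kk r hL k p.1) := by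
        rw [hψΔ]; simp only [LinearMap.comp_assoc]
    _ = mulOp (fun p : ScX' d L mv kk r hL × ι => scH' d L mv kk r hL k p.1) := by
        rw [cGreen_comp_lapOp_add_scQQ' ι ha, LinearMap.id_comp, ← mulOp_comp_mulOp_comm (fun p : ScX' d L mv kk r hL × ι => scH' d L mv kk r hL k p.1), hψh, hχth]

end Flat

end Summit.QuantumFields.YangMills.BalabanUVNodes.N15.Gluing

end
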